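import Literature.NumberTheory.Sieve.DrappeauDispersionLemmas
import Literature.NumberTheory.Sieve.BombieriFriedlanderIwaniecTheorem5Weights
import HarnessLib

/-!
# Drappeau 2017, §5.2 — the first reduction of Theorem 5.1: smoothing the cut-off `q ∼ Q`

Topic `Literature/NumberTheory/Sieve`, companion of `DrappeauDispersion` (which vendors Theorem 5.1 of
S. Drappeau, *Sums of Kloosterman sums in arithmetic progressions, and the error term in the dispersion
method*, Proc. London Math. Soc. (3) 114 (2017) 684–732 = arXiv:1504.05549, as the named fact
`Literature.NumberTheory.Sieve.Drappeau2017_theorem51`).  Everything here is PROVED; no definition and no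
named fact is introduced.

The printed proof of Theorem 5.1 (§5.2, arXiv p. 17) begins: "We replace the sharp cutoff `Q < q ≤ 2Q`
by a smooth weight `γ(q)` such that `1_{Q<q≤2Q} ≤ γ ≤ 1_{Q(1−Q^{−10δ}) ≤ q ≤ 2Q(1+Q^{−10δ})}` …
The error term in this procedure comes from the contribution of those integers `q` at the transition
range … It is bounded by the triangle inequality, using our trivial bound (5.2) [`|𝔲_R(n; q)| ≤
1_{n ≡ 1 (q)} + R τ(q)/φ(q)`] … We obtain (5.6)
`∑_{(q,a₁a₂)=1} (1_{Q<q≤2Q} − γ(q)) ∑∑ α_m β_n 𝔲_R(mn ā₁ a₂; q) ≪ x R (log x)^{O(1)} Q^{−10δ}`.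
Given our hypotheses `R ≤ x^δ` and `Q ≥ x^{1/4}`, this is an acceptable error term."

This file carries out exactly this step, for the tree's rendering of Theorem 5.1 (moduli `s ∼ S`,
conductor cut-off `Rd`) and the tree's smooth plateau `γ = BFI.bump S Y` (`= 1` on `[S, 2S]`, `= 0` off
`(S − Y, 2S + Y)`, values in `[0, 1]`, `‖γ⁽ʲ⁾‖_∞ ≤ 2K_j Y^{−j}`; file
`BombieriFriedlanderIwaniecTheorem5Weights`), with transition width `Y = S x^{−δ}`:

* `Drappeau2017.card_filter_kerArg_eq_one_le` — for fixed `n`, the `m ∼ M` with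
  `m n ā₁ a₂ ≡ 1 (mod s)` lie in one class mod `s`: at most `⌊2M⌋/s + 1` of them;
* `Drappeau2017.norm_bilinear_uR_le` — the trivial bound at one modulus obtained from (5.2):
  `‖∑_{m∼M}∑_{n∈𝒩} α_m β_n 𝔲_R(mn ā₁ a₂; s)‖ ≤ A B (#𝒩 (⌊2M⌋/s + 1) + R τ(s)/φ(s) #{m∼M} #𝒩)` when
  `‖α_m‖ ≤ A`, `‖β_n‖ ≤ B`;
* `Drappeau2017.norm_sharp_sub_smooth_le` — the sharp sum minus the `γ`-weighted sum is at most the sum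
  of `‖·‖` of the inner sums over the transition set `BFI.bumpDiffSupport S Y` (`#≤ 2Y + 2`);
* `Drappeau2017_theorem51_of_smooth` — **Theorem 5.1 follows from its smoothed form**: if the
  `γ`-weighted sum is `≤ C x (log x)^{c₀}/R` under the hypotheses of Theorem 5.1 for every transition
  width `S x^{−δ} ≤ Y ≤ S/4` (this is (5.6) = Proposition 5.3 of the paper for the weights `BFI.bump`,
  whose derivatives obey the required `‖γ⁽ʲ⁾‖_∞ ≪_j Q^{−j} x^{jδ}`, WITHOUT the restriction of `β` to
  squarefree integers — i.e. the statement reached after BOTH reductions of §5.2), then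
  `Drappeau2017_theorem51` holds.  The smoothing error is bounded with the pointwise divisor bound
  `τ(k) ≤ C_ε k^ε` (tree: `exists_sigma_zero_le_mul_rpow`), which suffices because the transition width
  carries the saving `x^{−δ}`: the error is `≪ R x^{1 − δ/2 + O(ε)} ≤ x/R` once `R ≤ x^{δ/4}`.

## References

* S. Drappeau, Proc. London Math. Soc. (3) 114 (2017) 684–732, arXiv:1504.05549, §5.2 (first
  reduction, (5.6)) and (5.2). [cite: Drappeau2017, §5.2 (5.6)]
* E. Bombieri, J. B. Friedlander, H. Iwaniec, Acta Math. 156 (1986), 203–251, §12 p. 235 (the smooth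
  weight). [cite: BombieriFriedlanderIwaniecActa1986, §12]
-/

noncomputable section

open Finset Real
open scoped ArithmeticFunction.sigma

namespace Literature.NumberTheory.Sieve

namespace Drappeau2017

/-! ### Counting one residue class -/

/-- Naturals `≤ X` in one residue class mod `s ≥ 1`: at most `X / s + 1` of them. [folklore] -/
theorem card_filter_natCast_eq_le {U : Finset ℕ} {X : ℕ} (hU : ∀ m ∈ U, m ≤ X) {s : ℕ} (hs : 0 < s)
    (r : ZMod s) : (U.filter (fun m : ℕ => (m : ZMod s) = r)).card ≤ X / s + 1 := by
  set V := U.filter (fun m : ℕ => (m : ZMod s) = r) with hV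
  have hmod : ∀ m ∈ V, ∀ m' ∈ V, m % s = m' % s := by
    intro m hm m' hm'
    rw [hV, Finset.mem_filter] at hm hm'
    exact (ZMod.natCast_eq_natCast_iff' _ _ _).1 (hm.2.trans hm'.2.symm)
  have hs' : s ≠ 0 := hs.ne'
  calc V.card ≤ (Finset.range (X / s + 1)).card := by
        refine Finset.card_le_card_of_injOn (fun m => m / s) (fun m hm => ?_)
          (fun m hm m' hm' h => ?_)
        · have hm' := hU m (Finset.mem_filter.1 (Finset.mem_coe.1 hm)).1
          exact Finset.mem_coe.2 (Finset.mem_range.2 (Nat.lt_succ_of_le (Nat.div_le_div_right hm')))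
        · have h' : m / s = m' / s := h
          have hm₁ := hmod m (Finset.mem_coe.1 hm) m' (Finset.mem_coe.1 hm')
          calc m = s * (m / s) + m % s := (Nat.div_add_mod m s).symm
            _ = s * (m' / s) + m' % s := by rw [h', hm₁]
            _ = m' := Nat.div_add_mod m' s
    _ = X / s + 1 := Finset.card_range _

/-- For fixed `n`, the `m ∼ M` with `m n ā₁ a₂ ≡ 1 (mod s)` lie in a single residue class mod `s` (and
there are none unless `n ā₁ a₂` is a unit), so there are at most `⌊2M⌋ / s + 1` of them. [folklore] -/
theorem card_filter_kerArg_eq_one_le {M : ℝ} (hM : 0 ≤ M) {s : ℕ} (hs : 0 < s) (a₁ a₂ : ℤ) (n : ℕ) :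
    ((BFI.dyadic M).filter (fun m : ℕ =>
        ((m * n : ℕ) : ZMod s) * ((a₁ : ZMod s))⁻¹ * (a₂ : ZMod s) = 1)).card ≤ ⌊2 * M⌋₊ / s + 1 := by
  set u : ZMod s := (n : ZMod s) * ((a₁ : ZMod s))⁻¹ * (a₂ : ZMod s) with hu
  refine le_trans (Finset.card_le_card ?_)
    (card_filter_natCast_eq_le (fun m hm => le_floor_of_mem_dyadic hM hm) hs u⁻¹)
  intro m hm
  rw [Finset.mem_filter] at hm ⊢
  refine ⟨hm.1, ?_⟩
  have h1 : (m : ZMod s) * u = 1 := by rw [hu, ← hm.2]; push_cast; ring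
  have hu' : IsUnit u := IsUnit.of_mul_eq_one_right _ h1
  calc (m : ZMod s) = (m : ZMod s) * (u * u⁻¹) := by rw [ZMod.mul_inv_of_unit u hu', mul_one]
    _ = u⁻¹ := by rw [← mul_assoc, h1, one_mul]

/-! ### The trivial bound at one modulus -/

/-- **The trivial bound for the bilinear sum at one modulus** (from (5.2),
`|𝔲_R(t; s)| ≤ 1_{t = 1} + R τ(s)/φ(s)`): if `‖α_m‖ ≤ A` on `m ∼ M` and `‖β_n‖ ≤ B` on `𝒩`, then
`‖∑_{m∼M} ∑_{n∈𝒩} α_m β_n 𝔲_R(mn ā₁ a₂; s)‖ ≤ A B (#𝒩 (⌊2M⌋/s + 1) + R τ(s)/φ(s) · #{m∼M} #𝒩)`.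
[cite: Drappeau2017, §5.1 (5.2)] -/
theorem norm_bilinear_uR_le {M : ℝ} (hM : 0 ≤ M) (𝒩 : Finset ℕ) {s : ℕ} (hs : 0 < s) {Rd : ℝ}
    (hRd : 0 ≤ Rd) (a₁ a₂ : ℤ) {α β : ℕ → ℂ} {A B : ℝ} (hA : 0 ≤ A) (hB : 0 ≤ B)
    (hα : ∀ m ∈ BFI.dyadic M, ‖α m‖ ≤ A) (hβ : ∀ n ∈ 𝒩, ‖β n‖ ≤ B) :
    ‖∑ m ∈ BFI.dyadic M, ∑ n ∈ 𝒩, α m * β n *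
        uR Rd s (((m * n : ℕ) : ZMod s) * ((a₁ : ZMod s))⁻¹ * (a₂ : ZMod s))‖ ≤
      A * B * ((𝒩.card : ℝ) * (((⌊2 * M⌋₊ / s : ℕ) : ℝ) + 1) +
        Rd * (σ 0 s : ℝ) / (Nat.totient s : ℝ) * ((BFI.dyadic M).card * 𝒩.card)) := by
  set c : ℝ := Rd * (σ 0 s : ℝ) / (Nat.totient s : ℝ) with hc
  have hc0 : 0 ≤ c := by positivity
  have hterm : ∀ m ∈ BFI.dyadic M, ∀ n ∈ 𝒩,
      ‖α m * β n * uR Rd s (((m * n : ℕ) : ZMod s) * ((a₁ : ZMod s))⁻¹ * (a₂ : ZMod s))‖ ≤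
        A * B * ((if ((m * n : ℕ) : ZMod s) * ((a₁ : ZMod s))⁻¹ * (a₂ : ZMod s) = 1
          then (1 : ℝ) else 0) + c) := by
    intro m hm n hn
    rw [norm_mul, norm_mul]
    have h1 := norm_uR_le hs hRd (((m * n : ℕ) : ZMod s) * ((a₁ : ZMod s))⁻¹ * (a₂ : ZMod s))
    have h2 : ‖α m‖ * ‖β n‖ ≤ A * B := mul_le_mul (hα m hm) (hβ n hn) (norm_nonneg _) hA
    exact mul_le_mul h2 h1 (norm_nonneg _) (mul_nonneg hA hB)
  have hinner : ∀ n ∈ 𝒩, ∑ m ∈ BFI.dyadic M,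
      ((if ((m * n : ℕ) : ZMod s) * ((a₁ : ZMod s))⁻¹ * (a₂ : ZMod s) = 1 then (1 : ℝ) else 0) + c) ≤
        ((((⌊2 * M⌋₊ / s : ℕ) : ℝ) + 1) + c * (BFI.dyadic M).card) := by
    intro n _
    rw [Finset.sum_add_distrib, Finset.sum_const, nsmul_eq_mul, Finset.sum_boole]
    refine add_le_add ?_ (le_of_eq (mul_comm _ _))
    exact_mod_cast card_filter_kerArg_eq_one_le hM hs a₁ a₂ n
  calc ‖∑ m ∈ BFI.dyadic M, ∑ n ∈ 𝒩, α m * β n *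
          uR Rd s (((m * n : ℕ) : ZMod s) * ((a₁ : ZMod s))⁻¹ * (a₂ : ZMod s))‖
      ≤ ∑ m ∈ BFI.dyadic M, ∑ n ∈ 𝒩, ‖α m * β n *
          uR Rd s (((m * n : ℕ) : ZMod s) * ((a₁ : ZMod s))⁻¹ * (a₂ : ZMod s))‖ :=
        (norm_sum_le _ _).trans (Finset.sum_le_sum fun m _ => norm_sum_le _ _)
    _ ≤ ∑ m ∈ BFI.dyadic M, ∑ n ∈ 𝒩, A * B *
          ((if ((m * n : ℕ) : ZMod s) * ((a₁ : ZMod s))⁻¹ * (a₂ : ZMod s) = 1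
            then (1 : ℝ) else 0) + c) :=
        Finset.sum_le_sum fun m hm => Finset.sum_le_sum fun n hn => hterm m hm n hn
    _ = A * B * ∑ n ∈ 𝒩, ∑ m ∈ BFI.dyadic M,
          ((if ((m * n : ℕ) : ZMod s) * ((a₁ : ZMod s))⁻¹ * (a₂ : ZMod s) = 1
            then (1 : ℝ) else 0) + c) := by
        rw [Finset.sum_comm]; simp_rw [← Finset.mul_sum]
    _ ≤ A * B * ∑ n ∈ 𝒩, ((((⌊2 * M⌋₊ / s : ℕ) : ℝ) + 1) + c * (BFI.dyadic M).card) :=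
        mul_le_mul_of_nonneg_left (Finset.sum_le_sum hinner) (mul_nonneg hA hB)
    _ = _ := by rw [Finset.sum_const, nsmul_eq_mul, hc]; ring

/-! ### The smoothing difference -/

/-- **Sharp minus smooth.**  With `γ = BFI.bump S Y` (`0 < Y ≤ S`), for any inner sums `F(s)` and any
side condition `P` on the moduli,
`‖∑_{s∼S, P s} F(s) − ∑_{s ≤ 2S+Y, P s} γ(s) F(s)‖ ≤ ∑_{s ∈ bumpDiffSupport S Y} ‖F(s)‖`:
the coefficient `1_{s∼S} − γ(s)` has absolute value `≤ 1` and vanishes off the two transition ranges.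
[cite: Drappeau2017, §5.2 (5.6)] -/
theorem norm_sharp_sub_smooth_le {S Y : ℝ} (hY : 0 < Y) (hYS : Y ≤ S) (P : ℕ → Prop)
    [DecidablePred P] (F : ℕ → ℂ) :
    ‖∑ s ∈ (BFI.dyadic S).filter P, F s -
        ∑ s ∈ (BFI.mRange S Y).filter P, ((BFI.bump S Y s : ℝ) : ℂ) * F s‖ ≤
      ∑ s ∈ BFI.bumpDiffSupport S Y, ‖F s‖ := by
  have hS : 0 ≤ S := hY.le.trans hYS
  set w : ℕ → ℝ := fun s => (if s ∈ BFI.dyadic S then (1 : ℝ) else 0) - BFI.bump S Y s with hw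
  have h1 : ∑ s ∈ (BFI.dyadic S).filter P, F s =
      ∑ s ∈ (BFI.mRange S Y).filter P, (if s ∈ BFI.dyadic S then F s else 0) := by
    rw [← Finset.sum_filter]
    refine Finset.sum_congr ?_ fun _ _ => rfl
    ext s
    simp only [Finset.mem_filter]
    constructor
    · rintro ⟨hs, hp⟩
      exact ⟨⟨BFI.dyadic_subset_mRange hY.le hs, hp⟩, hs⟩
    · rintro ⟨⟨-, hp⟩, hs⟩
      exact ⟨hs, hp⟩
  have h2 : ∑ s ∈ (BFI.dyadic S).filter P, F s -
      ∑ s ∈ (BFI.mRange S Y).filter P, ((BFI.bump S Y s : ℝ) : ℂ) * F s =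
      ∑ s ∈ (BFI.mRange S Y).filter P, ((w s : ℝ) : ℂ) * F s := by
    rw [h1, ← Finset.sum_sub_distrib]
    refine Finset.sum_congr rfl fun s _ => ?_
    rw [hw]
    dsimp only
    split_ifs <;> push_cast <;> ring
  rw [h2]
  have hw1 : ∀ s, ‖((w s : ℝ) : ℂ)‖ ≤ if s ∈ BFI.bumpDiffSupport S Y then (1 : ℝ) else 0 := by
    intro s
    rw [Complex.norm_real, Real.norm_eq_abs]
    split_ifs with hs
    · have hb := BFI.bump_mem_Icc hY hS (s : ℝ)
      rw [hw]
      dsimp only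
      rw [abs_le]
      split_ifs <;> constructor <;> linarith [hb.1, hb.2]
    · rw [abs_nonpos_iff]
      by_contra hne
      exact hs (BFI.mem_bumpDiffSupport hY hYS hne)
  calc ‖∑ s ∈ (BFI.mRange S Y).filter P, ((w s : ℝ) : ℂ) * F s‖
      ≤ ∑ s ∈ (BFI.mRange S Y).filter P, ‖((w s : ℝ) : ℂ) * F s‖ := norm_sum_le _ _
    _ ≤ ∑ s ∈ (BFI.mRange S Y).filter P, (if s ∈ BFI.bumpDiffSupport S Y then ‖F s‖ else 0) := by
        refine Finset.sum_le_sum fun s _ => ?_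
        rw [norm_mul]
        calc ‖((w s : ℝ) : ℂ)‖ * ‖F s‖
            ≤ (if s ∈ BFI.bumpDiffSupport S Y then (1 : ℝ) else 0) * ‖F s‖ :=
              mul_le_mul_of_nonneg_right (hw1 s) (norm_nonneg _)
          _ = _ := by split_ifs <;> simp
    _ = ∑ s ∈ ((BFI.mRange S Y).filter P).filter (· ∈ BFI.bumpDiffSupport S Y), ‖F s‖ :=
        (Finset.sum_filter _ _).symm
    _ ≤ ∑ s ∈ BFI.bumpDiffSupport S Y, ‖F s‖ :=
        Finset.sum_le_sum_of_subset_of_nonneg (fun s hs => (Finset.mem_filter.1 hs).2)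
          fun _ _ _ => norm_nonneg _

end Drappeau2017

set_option maxHeartbeats 400000 in
open Drappeau2017 in
/-- **Drappeau 2017, §5.2: Theorem 5.1 follows from its smoothed form.**  Suppose that for every
`η > 0` there is `δ > 0` such that for every `A ≥ 0` there are `C, c₀, x₀` with: for `x ≥ x₀` and all data
`M, N, S, Rd, a₁, a₂, α, β` as in Theorem 5.1 (with this `δ`), and every transition width
`S x^{−δ} ≤ Y ≤ S/4`, the `γ`-weighted sum with `γ = BFI.bump S Y` satisfies
`‖∑_{(s, a₁a₂)=1} γ(s) ∑_{m∼M} ∑_{n∼N, (n,a₂)=1} α_m β_n 𝔲_R(mn ā₁ a₂; s)‖ ≤ C x (log x)^{c₀}/Rd`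
— the smoothed statement (5.6)/Proposition 5.3 of the paper for these weights (whose derivatives obey
`‖γ⁽ʲ⁾‖_∞ ≤ 2K_j Y^{−j} ≤ 2K_j S^{−j} x^{jδ}`), after the squarefree reduction.  Then Theorem 5.1
(`Drappeau2017_theorem51`) holds: with `Y = S x^{−δ₁}` (`δ₁ = min(δ, 1/100)`, and Theorem 5.1 taken
with `δ₁/4`) the smoothing error is, by the trivial bound (5.2) and `τ(k) ≤ C_ε k^ε`,
`≤ 216 C_ε^{2A+2} Rd x^{1−δ₁/2} ≤ 216 C_ε^{2A+2} x/Rd`.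
[cite: Drappeau2017, §5.2 (5.6)] -/
theorem Drappeau2017_theorem51_of_smooth
    (H : ∀ η : ℝ, 0 < η → ∃ δ : ℝ, 0 < δ ∧ ∀ Aτ : ℝ, 0 ≤ Aτ → ∃ C c₀ x₀ : ℝ, ∀ x : ℝ, x₀ ≤ x →
      ∀ M N S Rd Y : ℝ, M * N = x → x ^ η ≤ N → N ≤ S ^ (2 / 3 - η) → x ^ (1 / 4 : ℝ) ≤ S →
        S ≤ x ^ (1 / 2 + δ) → 1 ≤ Rd → Rd ≤ x ^ δ → S * x ^ (-δ) ≤ Y → Y ≤ S / 4 →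
      ∀ a₁ a₂ : ℤ, a₁ ≠ 0 → a₂ ≠ 0 → (|a₁| : ℝ) ≤ x ^ δ → (|a₂| : ℝ) ≤ x ^ δ →
      ∀ α β : ℕ → ℂ, (∀ m, ‖α m‖ ≤ (σ 0 m : ℝ) ^ Aτ) → (∀ n, ‖β n‖ ≤ (σ 0 n : ℝ) ^ Aτ) →
        ‖∑ s ∈ (BFI.mRange S Y).filter (fun s : ℕ => IsCoprime (s : ℤ) (a₁ * a₂)),
            ((BFI.bump S Y s : ℝ) : ℂ) *
              ∑ m ∈ BFI.dyadic M, ∑ n ∈ (BFI.dyadic N).filter (fun n : ℕ => IsCoprime (n : ℤ) a₂),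
                α m * β n *
                  uR Rd s (((m * n : ℕ) : ZMod s) * ((a₁ : ZMod s))⁻¹ * ((a₂ : ZMod s)))‖ ≤
          C * x * Real.log x ^ c₀ / Rd) :
    Drappeau2017_theorem51 := by
  intro η hη
  obtain ⟨δH, hδH, Hδ⟩ := H η hη
  set δ₁ : ℝ := min δH (1 / 100) with hδ₁
  have hδ₁0 : 0 < δ₁ := lt_min hδH (by norm_num)
  have hδ₁H : δ₁ ≤ δH := min_le_left _ _
  have hδ₁1 : δ₁ ≤ 1 / 100 := min_le_right _ _
  refine ⟨δ₁ / 4, by positivity, fun Aτ hAτ => ?_⟩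
  obtain ⟨C, c₀, x₀, HC⟩ := Hδ Aτ hAτ
  -- the pointwise divisor bound, exponent `ε = δ₁ / (4 (A + 1))`
  set ε : ℝ := δ₁ / (4 * (Aτ + 1)) with hε
  have hε0 : 0 < ε := by positivity
  obtain ⟨Cτ, hCτ1, hCτ⟩ := exists_sigma_zero_le_mul_rpow hε0
  have hCτ0 : 0 < Cτ := by linarith
  set X₁ : ℝ := max (max x₀ 3) ((4 : ℝ) ^ (1 / δ₁)) with hX₁
  refine ⟨max C 0 + 216 * Cτ ^ (2 * Aτ + 2), max c₀ 0, X₁, fun x hx M N S Rd hMN hN hNS hS hSx hRd1 hRd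
    a₁ a₂ ha₁ ha₂ ha₁x ha₂x α β hα hβ => ?_⟩
  -- ### sizes
  have hx₀ : x₀ ≤ x := le_trans (le_trans (le_max_left _ _) (le_max_left _ _)) hx
  have hx3 : 3 ≤ x := le_trans (le_trans (le_max_right _ _) (le_max_left _ _)) hx
  have hx4 : (4 : ℝ) ^ (1 / δ₁) ≤ x := le_trans (le_max_right _ _) hx
  have hx1 : 1 ≤ x := by linarith
  have hx0 : 0 < x := by linarith
  have hL1 : 1 ≤ Real.log x := by
    rw [Real.le_log_iff_exp_le (by linarith)]
    have := Real.exp_one_lt_d9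
    linarith
  have hN0 : 0 < N := lt_of_lt_of_le (Real.rpow_pos_of_pos hx0 η) hN
  have hM0 : 0 < M := by
    by_contra h
    have : M * N ≤ 0 := mul_nonpos_of_nonpos_of_nonneg (not_lt.1 h) hN0.le
    linarith
  have hS0 : 0 < S := lt_of_lt_of_le (Real.rpow_pos_of_pos hx0 _) hS
  have hS1 : 1 ≤ S := le_trans (Real.one_le_rpow hx1 (by norm_num)) hS
  have hRd0 : 0 < Rd := by linarith
  have hxδ4 : 4 ≤ x ^ δ₁ := by
    calc (4 : ℝ) = ((4 : ℝ) ^ (1 / δ₁)) ^ δ₁ := by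
          rw [← Real.rpow_mul (by norm_num), one_div_mul_cancel hδ₁0.ne', Real.rpow_one]
      _ ≤ x ^ δ₁ := Real.rpow_le_rpow (by positivity) hx4 hδ₁0.le
  have hxδ0 : 0 < x ^ δ₁ := Real.rpow_pos_of_pos hx0 _
  have hxnegδ : x ^ (-δ₁) = (x ^ δ₁)⁻¹ := Real.rpow_neg hx0.le δ₁
  -- the transition width
  set Y : ℝ := S * x ^ (-δ₁) with hYdef
  have hY0 : 0 < Y := mul_pos hS0 (Real.rpow_pos_of_pos hx0 _)
  have hYS4 : Y ≤ S / 4 := by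
    rw [hYdef, hxnegδ, div_eq_mul_inv]
    exact mul_le_mul_of_nonneg_left (by
      rw [inv_le_inv₀ hxδ0 (by norm_num)]; exact hxδ4) hS0.le
  have hYS2 : Y ≤ S / 2 := by linarith
  have hYS : Y ≤ S := by linarith
  -- monotonicity of `x ^ ·`
  have hmono : ∀ {u v : ℝ}, u ≤ v → x ^ u ≤ x ^ v := fun h => Real.rpow_le_rpow_of_exponent_le hx1 h
  have hle1 : ∀ {u : ℝ}, u ≤ 1 → x ^ u ≤ x := fun h => (hmono h).trans_eq (Real.rpow_one x)
  -- ### the smoothed sum, bounded by the hypothesis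
  have hSx' : S ≤ x ^ (1 / 2 + δH) := hSx.trans (hmono (by linarith))
  have hRd' : Rd ≤ x ^ δH := hRd.trans (hmono (by linarith))
  have ha₁' : (|a₁| : ℝ) ≤ x ^ δH := ha₁x.trans (hmono (by linarith))
  have ha₂' : (|a₂| : ℝ) ≤ x ^ δH := ha₂x.trans (hmono (by linarith))
  have hY1 : S * x ^ (-δH) ≤ Y := mul_le_mul_of_nonneg_left (hmono (by linarith)) hS0.le
  have hmain := HC x hx₀ M N S Rd Y hMN hN hNS hS hSx' hRd1 hRd' hY1 hYS4 a₁ a₂ ha₁ ha₂ ha₁' ha₂'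
    α β hα hβ
  -- ### the smoothing error
  set ℳ := BFI.dyadic M with hℳ
  set 𝒩 := (BFI.dyadic N).filter (fun n : ℕ => IsCoprime (n : ℤ) a₂) with h𝒩
  set T := BFI.bumpDiffSupport S Y with hT
  set F : ℕ → ℂ := fun s => ∑ m ∈ ℳ, ∑ n ∈ 𝒩, α m * β n *
    uR Rd s (((m * n : ℕ) : ZMod s) * ((a₁ : ZMod s))⁻¹ * ((a₂ : ZMod s))) with hF
  have hdiff := norm_sharp_sub_smooth_le hY0 hYS (fun s : ℕ => IsCoprime (s : ℤ) (a₁ * a₂)) F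
  -- uniform divisor bound `τ(k) ≤ E` for `k ≤ 3x`
  set E : ℝ := Cτ * (3 * x) ^ ε with hE
  have h3x1 : 1 ≤ 3 * x := by linarith
  have hE1 : 1 ≤ E := by
    calc (1 : ℝ) = 1 * 1 := by ring
      _ ≤ Cτ * (3 * x) ^ ε := mul_le_mul hCτ1 (Real.one_le_rpow h3x1 hε0.le) zero_le_one hCτ0.le
  have hE0 : 0 < E := by linarith
  have hτE : ∀ k : ℕ, (k : ℝ) ≤ 3 * x → (σ 0 k : ℝ) ≤ E := by
    intro k hk
    calc (σ 0 k : ℝ) ≤ Cτ * (k : ℝ) ^ ε := by exact_mod_cast hCτ k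
      _ ≤ Cτ * (3 * x) ^ ε :=
          mul_le_mul_of_nonneg_left (Real.rpow_le_rpow (Nat.cast_nonneg k) hk hε0.le) hCτ0.le
  have hEA1 : 1 ≤ E ^ Aτ := Real.one_le_rpow hE1 hAτ
  have hEA0 : 0 ≤ E ^ Aτ := by linarith
  -- sizes of the ranges
  have hM_le : 2 * M ≤ 3 * x := by
    have hN1 : 1 ≤ N := le_trans (Real.one_le_rpow hx1 hη.le) hN
    have : M ≤ x := by
      calc M = M * 1 := (mul_one M).symm
        _ ≤ M * N := mul_le_mul_of_nonneg_left hN1 hM0.le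
        _ = x := hMN
    linarith
  have hNx : N ≤ x ^ (1 - δ₁) := by
    have h1 : N ≤ S ^ (2 / 3 : ℝ) := hNS.trans (Real.rpow_le_rpow_of_exponent_le hS1 (by linarith))
    have h2 : S ^ (2 / 3 : ℝ) ≤ (x ^ (1 / 2 + δ₁ / 4)) ^ (2 / 3 : ℝ) :=
      Real.rpow_le_rpow hS0.le hSx (by norm_num)
    rw [← Real.rpow_mul hx0.le] at h2
    exact h1.trans (h2.trans (hmono (by linarith)))
  have hx1δ : x ^ (1 - δ₁) ≤ x := hle1 (by linarith)
  have hN_le : 2 * N ≤ 3 * x := by linarith [hNx.trans hx1δ]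
  have hNS_le : N * S ≤ x := by
    have h1 : N ≤ S ^ (2 / 3 : ℝ) := hNS.trans (Real.rpow_le_rpow_of_exponent_le hS1 (by linarith))
    have h2 : N * S ≤ S ^ (2 / 3 : ℝ) * S := mul_le_mul_of_nonneg_right h1 hS0.le
    have h3 : S ^ (2 / 3 : ℝ) * S = S ^ (5 / 3 : ℝ) := by
      rw [← Real.rpow_add_one hS0.ne']; norm_num
    have h4 : S ^ (5 / 3 : ℝ) ≤ (x ^ (1 / 2 + δ₁ / 4)) ^ (5 / 3 : ℝ) :=
      Real.rpow_le_rpow hS0.le hSx (by norm_num)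
    rw [← Real.rpow_mul hx0.le] at h4
    have h5 : x ^ ((1 / 2 + δ₁ / 4) * (5 / 3 : ℝ)) ≤ x := hle1 (by linarith)
    linarith
  have hxS : x / S ≤ x ^ (1 - δ₁) := by
    rw [div_le_iff₀ hS0]
    calc x = x ^ (1 - δ₁) * x ^ δ₁ := by
          rw [← Real.rpow_add hx0]; norm_num
      _ ≤ x ^ (1 - δ₁) * S := by
          refine mul_le_mul_of_nonneg_left ?_ (by positivity)
          exact le_trans (hmono (by linarith)) hS
  have hxYS : x * Y / S = x ^ (1 - δ₁) := by
    rw [hYdef, Real.rpow_sub hx0, Real.rpow_one, hxnegδ]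
    field_simp
  have hNY : N * Y ≤ x ^ (1 - δ₁) := by
    rw [← hxYS, hYdef]
    rw [show x * (S * x ^ (-δ₁)) / S = x * x ^ (-δ₁) by field_simp]
    calc N * (S * x ^ (-δ₁)) = N * S * x ^ (-δ₁) := by ring
      _ ≤ x * x ^ (-δ₁) := mul_le_mul_of_nonneg_right hNS_le (by positivity)
  have hcardℳ : (ℳ.card : ℝ) ≤ 2 * M := card_dyadic_le hM0.le
  have hcard𝒩 : (𝒩.card : ℝ) ≤ 2 * N :=
    le_trans (by exact_mod_cast Finset.card_filter_le _ _) (card_dyadic_le hN0.le)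
  have hcardT : (T.card : ℝ) ≤ 2 * Y + 2 := BFI.card_bumpDiffSupport_le hY0.le hYS
  -- ### the bound at one modulus of the transition range
  have hFs : ∀ s ∈ T, ‖F s‖ ≤ E ^ Aτ * E ^ Aτ * (E * E) * Rd * (16 * (x / S) + 2 * N) := by
    intro s hs
    have hsY : S - Y < s := BFI.lt_of_mem_bumpDiffSupport hY0.le hYS hs
    have hsS : S / 2 < s := by linarith
    have hs0' : (0 : ℝ) < s := by linarith
    have hs0 : 0 < s := by exact_mod_cast hs0'
    have hs3x : (s : ℝ) ≤ 3 * x := by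
      have h1 : s ≤ ⌊2 * S + Y⌋₊ := by
        rw [hT, BFI.bumpDiffSupport, Finset.mem_union, Finset.mem_Ioc, Finset.mem_Ioc] at hs
        rcases hs with ⟨-, h⟩ | ⟨-, h⟩
        · exact h.trans (Nat.floor_mono (by linarith))
        · exact h
      have h2 : (s : ℝ) ≤ 2 * S + Y := le_trans (by exact_mod_cast h1) (Nat.floor_le (by linarith))
      have h3 : S ≤ x := by
        exact hSx.trans (hle1 (by linarith))
      linarith
    have hα' : ∀ m ∈ ℳ, ‖α m‖ ≤ E ^ Aτ := by
      intro m hm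
      have hm2 : (m : ℝ) ≤ 2 * M := ((BFI.mem_dyadic hM0.le).1 hm).2
      exact (hα m).trans (Real.rpow_le_rpow (Nat.cast_nonneg _) (hτE m (hm2.trans hM_le)) hAτ)
    have hβ' : ∀ n ∈ 𝒩, ‖β n‖ ≤ E ^ Aτ := by
      intro n hn
      have hn2 : (n : ℝ) ≤ 2 * N := ((BFI.mem_dyadic hN0.le).1 (Finset.mem_filter.1 hn).1).2
      exact (hβ n).trans (Real.rpow_le_rpow (Nat.cast_nonneg _) (hτE n (hn2.trans hN_le)) hAτ)
    have h1 := norm_bilinear_uR_le hM0.le 𝒩 hs0 hRd0.le a₁ a₂ hEA0 hEA0 hα' hβ'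
    -- the pieces
    have hq : (((⌊2 * M⌋₊ / s : ℕ) : ℝ) + 1) ≤ 4 * M / S + 1 := by
      refine add_le_add ?_ le_rfl
      calc (((⌊2 * M⌋₊ / s : ℕ) : ℝ)) ≤ (⌊2 * M⌋₊ : ℝ) / s := Nat.cast_div_le
        _ ≤ 2 * M / s := div_le_div_of_nonneg_right (Nat.floor_le (by linarith)) hs0'.le
        _ ≤ 2 * M / (S / 2) := div_le_div_of_nonneg_left (by linarith) (by linarith) hsS.le
        _ = 4 * M / S := by field_simp; ring
    have hφ : Rd * (σ 0 s : ℝ) / (Nat.totient s : ℝ) ≤ Rd * (E * E) * (2 / S) := by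
      have h2 := inv_totient_le_sigma_zero_div s
      have hτs := hτE s hs3x
      have hσ0 : (0 : ℝ) ≤ (σ 0 s : ℝ) := Nat.cast_nonneg _
      calc Rd * (σ 0 s : ℝ) / (Nat.totient s : ℝ) = Rd * ((σ 0 s : ℝ) * ((Nat.totient s : ℝ))⁻¹) := by
            ring
        _ ≤ Rd * ((σ 0 s : ℝ) * ((σ 0 s : ℝ) / s)) :=
            mul_le_mul_of_nonneg_left (mul_le_mul_of_nonneg_left h2 hσ0) hRd0.le
        _ = Rd * ((σ 0 s : ℝ) * (σ 0 s : ℝ)) * (1 / s) := by ring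
        _ ≤ Rd * (E * E) * (2 / S) := by
            refine mul_le_mul (mul_le_mul_of_nonneg_left (mul_le_mul hτs hτs hσ0 hE0.le) hRd0.le)
              ?_ (by positivity) (by positivity)
            rw [div_le_div_iff₀ hs0' hS0]; linarith
    calc ‖F s‖ ≤ E ^ Aτ * E ^ Aτ * ((𝒩.card : ℝ) * (((⌊2 * M⌋₊ / s : ℕ) : ℝ) + 1) +
          Rd * (σ 0 s : ℝ) / (Nat.totient s : ℝ) * ((ℳ.card : ℝ) * 𝒩.card)) := h1
      _ ≤ E ^ Aτ * E ^ Aτ * ((2 * N) * (4 * M / S + 1) +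
          Rd * (E * E) * (2 / S) * ((2 * M) * (2 * N))) := by
          refine mul_le_mul_of_nonneg_left (add_le_add ?_ ?_) (by positivity)
          · exact mul_le_mul hcard𝒩 hq (by positivity) (by positivity)
          · exact mul_le_mul hφ (mul_le_mul hcardℳ hcard𝒩 (by positivity) (by positivity))
              (by positivity) (by positivity)
      _ = E ^ Aτ * E ^ Aτ * (8 * (x / S) + 2 * N + Rd * (E * E) * (8 * (x / S))) := by
          rw [← hMN]; field_simp; ring
      _ ≤ E ^ Aτ * E ^ Aτ * ((E * E) * Rd * (8 * (x / S) + 2 * N) + Rd * (E * E) * (8 * (x / S))) := by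
          refine mul_le_mul_of_nonneg_left (add_le_add ?_ le_rfl) (by positivity)
          have h0 : 0 ≤ 8 * (x / S) + 2 * N := by positivity
          calc 8 * (x / S) + 2 * N = 1 * 1 * (8 * (x / S) + 2 * N) := by ring
            _ ≤ (E * E) * Rd * (8 * (x / S) + 2 * N) := by
                refine mul_le_mul_of_nonneg_right ?_ h0
                exact mul_le_mul ((one_mul (1:ℝ)).symm.le.trans (mul_le_mul hE1 hE1 zero_le_one hE0.le)) hRd1
                  zero_le_one (by positivity)
      _ = E ^ Aτ * E ^ Aτ * (E * E) * Rd * (16 * (x / S) + 2 * N) := by ring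
  -- ### summing over the transition range
  have hpow : E ^ Aτ * E ^ Aτ * (E * E) ≤ 3 * Cτ ^ (2 * Aτ + 2) * x ^ (δ₁ / 2) := by
    have h1 : E ^ Aτ * E ^ Aτ * (E * E) = E ^ (2 * Aτ + 2) := by
      rw [show E * E = E ^ (2 : ℝ) by rw [Real.rpow_two]; ring, ← Real.rpow_add hE0,
        ← Real.rpow_add hE0]
      ring_nf
    have h2 : E ^ (2 * Aτ + 2) = Cτ ^ (2 * Aτ + 2) * (3 * x) ^ (δ₁ / 2) := by
      rw [hE, Real.mul_rpow hCτ0.le (by positivity), ← Real.rpow_mul (by positivity)]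
      congr 2
      rw [hε]; field_simp; ring
    have h3 : (3 * x) ^ (δ₁ / 2) ≤ 3 * x ^ (δ₁ / 2) := by
      rw [Real.mul_rpow (by norm_num) hx0.le]
      refine mul_le_mul_of_nonneg_right ?_ (by positivity)
      calc (3 : ℝ) ^ (δ₁ / 2) ≤ (3 : ℝ) ^ (1 : ℝ) :=
            Real.rpow_le_rpow_of_exponent_le (by norm_num) (by linarith)
        _ = 3 := Real.rpow_one _
    rw [h1, h2]
    calc Cτ ^ (2 * Aτ + 2) * (3 * x) ^ (δ₁ / 2) ≤ Cτ ^ (2 * Aτ + 2) * (3 * x ^ (δ₁ / 2)) :=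
          mul_le_mul_of_nonneg_left h3 (by positivity)
      _ = _ := by ring
  have herr : ∑ s ∈ T, ‖F s‖ ≤ 216 * Cτ ^ (2 * Aτ + 2) * x / Rd := by
    have h1 : ∑ s ∈ T, ‖F s‖ ≤ T.card • (E ^ Aτ * E ^ Aτ * (E * E) * Rd * (16 * (x / S) + 2 * N)) :=
      Finset.sum_le_card_nsmul _ _ _ hFs
    rw [nsmul_eq_mul] at h1
    have h2 : (T.card : ℝ) * (16 * (x / S) + 2 * N) ≤ 72 * x ^ (1 - δ₁) := by
      calc (T.card : ℝ) * (16 * (x / S) + 2 * N) ≤ (2 * Y + 2) * (16 * (x / S) + 2 * N) :=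
            mul_le_mul_of_nonneg_right hcardT (by positivity)
        _ = 32 * (x * Y / S) + 4 * (N * Y) + 32 * (x / S) + 4 * N := by ring
        _ ≤ 32 * x ^ (1 - δ₁) + 4 * x ^ (1 - δ₁) + 32 * x ^ (1 - δ₁) + 4 * x ^ (1 - δ₁) := by
            rw [hxYS]; gcongr
        _ = 72 * x ^ (1 - δ₁) := by ring
    have h3 : x ^ (δ₁ / 2) * Rd * x ^ (1 - δ₁) ≤ x / Rd := by
      rw [le_div_iff₀ hRd0]
      have hR2 : Rd * Rd ≤ x ^ (δ₁ / 2) := by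
        calc Rd * Rd ≤ x ^ (δ₁ / 4) * x ^ (δ₁ / 4) := mul_le_mul hRd hRd hRd0.le (by positivity)
          _ = x ^ (δ₁ / 2) := by rw [← Real.rpow_add hx0]; ring_nf
      calc x ^ (δ₁ / 2) * Rd * x ^ (1 - δ₁) * Rd = (Rd * Rd) * (x ^ (δ₁ / 2) * x ^ (1 - δ₁)) := by ring
        _ ≤ x ^ (δ₁ / 2) * (x ^ (δ₁ / 2) * x ^ (1 - δ₁)) :=
            mul_le_mul_of_nonneg_right hR2 (by positivity)
        _ = x := by
            rw [← Real.rpow_add hx0, ← Real.rpow_add hx0]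
            have : δ₁ / 2 + (δ₁ / 2 + (1 - δ₁)) = 1 := by ring
            rw [this, Real.rpow_one]
    calc ∑ s ∈ T, ‖F s‖ ≤ (T.card : ℝ) * (E ^ Aτ * E ^ Aτ * (E * E) * Rd * (16 * (x / S) + 2 * N)) := h1
      _ = (E ^ Aτ * E ^ Aτ * (E * E)) * Rd * ((T.card : ℝ) * (16 * (x / S) + 2 * N)) := by ring
      _ ≤ (3 * Cτ ^ (2 * Aτ + 2) * x ^ (δ₁ / 2)) * Rd * (72 * x ^ (1 - δ₁)) :=
          mul_le_mul (mul_le_mul_of_nonneg_right hpow hRd0.le) h2 (by positivity) (by positivity)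
      _ = 216 * Cτ ^ (2 * Aτ + 2) * (x ^ (δ₁ / 2) * Rd * x ^ (1 - δ₁)) := by ring
      _ ≤ 216 * Cτ ^ (2 * Aτ + 2) * (x / Rd) := mul_le_mul_of_nonneg_left h3 (by positivity)
      _ = _ := by ring
  -- ### conclusion
  have hlog0 : 0 < Real.log x := by linarith
  have hLc : Real.log x ^ c₀ ≤ Real.log x ^ max c₀ 0 :=
    Real.rpow_le_rpow_of_exponent_le hL1 (le_max_left _ _)
  have hLc1 : 1 ≤ Real.log x ^ max c₀ 0 := Real.one_le_rpow hL1 (le_max_right _ _)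
  have hmain' : ‖∑ s ∈ (BFI.mRange S Y).filter (fun s : ℕ => IsCoprime (s : ℤ) (a₁ * a₂)),
      ((BFI.bump S Y s : ℝ) : ℂ) * F s‖ ≤ max C 0 * x * Real.log x ^ max c₀ 0 / Rd := by
    refine hmain.trans ?_
    rw [div_le_div_iff_of_pos_right hRd0]
    calc C * x * Real.log x ^ c₀ ≤ max C 0 * x * Real.log x ^ c₀ := by
          gcongr; exact le_max_left _ _
      _ ≤ max C 0 * x * Real.log x ^ max c₀ 0 :=
          mul_le_mul_of_nonneg_left hLc (by positivity)
  have herr' : ∑ s ∈ T, ‖F s‖ ≤ 216 * Cτ ^ (2 * Aτ + 2) * x * Real.log x ^ max c₀ 0 / Rd := by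
    refine herr.trans ?_
    rw [div_le_div_iff_of_pos_right hRd0]
    calc 216 * Cτ ^ (2 * Aτ + 2) * x = 216 * Cτ ^ (2 * Aτ + 2) * x * 1 := by ring
      _ ≤ _ := mul_le_mul_of_nonneg_left hLc1 (by positivity)
  calc ‖∑ s ∈ (BFI.dyadic S).filter (fun s : ℕ => IsCoprime (s : ℤ) (a₁ * a₂)), F s‖
      = ‖(∑ s ∈ (BFI.dyadic S).filter (fun s : ℕ => IsCoprime (s : ℤ) (a₁ * a₂)), F s -
          ∑ s ∈ (BFI.mRange S Y).filter (fun s : ℕ => IsCoprime (s : ℤ) (a₁ * a₂)),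
            ((BFI.bump S Y s : ℝ) : ℂ) * F s) +
          ∑ s ∈ (BFI.mRange S Y).filter (fun s : ℕ => IsCoprime (s : ℤ) (a₁ * a₂)),
            ((BFI.bump S Y s : ℝ) : ℂ) * F s‖ := by rw [sub_add_cancel]
    _ ≤ ∑ s ∈ T, ‖F s‖ + max C 0 * x * Real.log x ^ max c₀ 0 / Rd :=
        (norm_add_le _ _).trans (add_le_add hdiff hmain')
    _ ≤ 216 * Cτ ^ (2 * Aτ + 2) * x * Real.log x ^ max c₀ 0 / Rd +
          max C 0 * x * Real.log x ^ max c₀ 0 / Rd := add_le_add herr' le_rfl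
    _ = (max C 0 + 216 * Cτ ^ (2 * Aτ + 2)) * x * Real.log x ^ max c₀ 0 / Rd := by ring

end Literature.NumberTheory.Sieve

end
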